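import Summits.QuantumFields.YangMills.Theorems.ColdStartUniversalityLatticeLangevinRiemannLipschitz
import HarnessLib

/-!
# Shen–Zhu–Zhu's Theorem 4.2 (4.5) IN LIPSCHITZ (`W₁`-DUAL) FORM for the `SU(2)` lattice Langevin dynamics on `(ℤ/L)³`, uniformly in the volume:
# `|P_t F(Q) − P_t F(Q')| ≤ e^(−(1−12|β'|)t) · √(sup Γ^A(f)/2) · ρ_L(Q,Q')` for `|β'| < 1/12`

Seat `ym-line-csu-p1` (g41), route `ColdStartUniversality` of `Summits/QuantumFields/YangMills`, helper file G43 (`--supports stmt-QuantumFields-24809`).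
Shen–Zhu–Zhu's Theorem 4.2 states the `W₂` contraction `W₂^(ρ_L)(δ_Q P_t, δ_(Q') P_t) ≤ e^(−K_𝒮 t) ρ_L(Q,Q')` (4.5) of the lattice Langevin dynamics
under the Bakry–Émery condition (the Literature's named fact `shenZhuZhu_finiteVolumeErgodicity`, not discharged).  By Kantorovich–Rubinstein duality
its `W₁` shadow is the exponential decay of the `ρ_L`-LIPSCHITZ constant of `x ↦ P_t F(x)`.  The seat's g29 gradient bound (`wilson_lipschitz_contraction_uniform`:
`Γ^A(κ_t F) ≤ e^(−2(1−12|β'|)t)·sup Γ^A(f)`, volume-uniform, rate `1 − 12|β'| ≥` SZZ's `K_𝒮 = 1 − 16|β'|` at `N = 2`, `d = 3`) and G42's bridge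
(`Γ^A ≤ σ² ⇒ √(σ²/2)`-Lipschitz in `ρ_L`) give it kernel-checked:

* ★★★ `wilson_transition_lipschitz_riemann_uniform` — for `|β'| < 1/12`, every torus size `L`, every realising Markov kernel family `κ_t(x,·) = law(U_t^x)`,
  every `C⁵` `f` with `Γ^A(f) ≤ σ²` on the group, every `t ≥ 0` and all `Q, Q' ∈ SU(2)^E`:
  `|∫ f∘coords dκ_t(Q) − ∫ f∘coords dκ_t(Q')| ≤ e^(−(1−12|β'|)t) · √(σ²/2) · ρ_L(Q,Q')` — i.e. the `ρ_L`-Lipschitz seminorm of `P_t F` decays at the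
  volume-independent rate `1 − 12|β'|`, with NO burn-in and NO entropy/variance budget;
* ★★ `wilson_transition_lipschitz_frob_uniform` — the same with `ρ_L ≤ (π/2)·√(Σ_e ‖Q'_e − Q_e‖_F²)` (G41): Frobenius currency, universal factor `π/2`.

THEOREMS ONLY, no definition, no sorry.  HONEST FRAMING: fixed cut-off; "uniform" = in `L` at fixed `|β'| < 1/12` (strong coupling / high temperature)
— the route's scaling `β'_K = (γε_K)⁻¹/2 → ∞` leaves this window; the `W₂` statement (4.5) itself is NOT proved (the named fact stays undischarged);
nothing `K`-uniform; `UniformColdStartMixing` (24809, ASIDE) is not restated; no crux, rung or summit statement is proved; the Yang–Mills mass gap is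
NOT proved.

References: H. Shen, R. Zhu, X. Zhu, CMP 400 (2023) 805–851 = arXiv:2204.12737, Thm 4.2 (4.5), Cor. 4.4, (4.7)–(4.8) [ShenZhuZhu2022]; D. Bakry,
I. Gentil, M. Ledoux, Grundlehren 348 (2014), Thm 3.2.3 / (3.2.4), Thm 3.3.18 [BakryGentilLedoux2014]; M.-K. von Renesse, K.-T. Sturm, CPAM 58 (2005)
923–940, Thm 1 (gradient estimate ⇔ Wasserstein contraction) [vonRenesseSturm2005].
-/

set_option autoImplicit false

noncomputable section

namespace Summit.QuantumFields.YangMills.Theorems.ColdStartUniversality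

open MeasureTheory ProbabilityTheory Matrix Complex Finset Filter Topology Set
open scoped ComplexConjugate BigOperators Real NNReal ENNReal
open Literature.MathematicalPhysics.QuantumFieldTheory
open Literature.MathematicalPhysics.QuantumLattice (fundamentalRep fundamentalLatticeRep continuous_fundamentalRep fundamentalRep_apply fundamentalLatticeRep_N)

/-- `√(e^(−2bc)·σ²/2) = e^(−bc)·√(σ²/2)`. [folklore] -/
theorem sqrt_exp_neg_two_mul_mul_div_two (b c σ2 : ℝ) :
    Real.sqrt (Real.exp (-(2 * b * c)) * σ2 / 2) = Real.exp (-(b * c)) * Real.sqrt (σ2 / 2) := by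
  have he : Real.exp (-(2 * b * c)) = Real.exp (-(b * c)) ^ 2 := by rw [← Real.exp_nat_mul]; congr 1; ring
  rw [he, mul_div_assoc, Real.sqrt_mul (sq_nonneg _), Real.sqrt_sq (Real.exp_pos _).le]

/-- ★★★ **Shen–Zhu–Zhu's Theorem 4.2 (4.5) in Lipschitz (`W₁`-dual) form, uniformly in the volume.**  At `|β'| < 1/12`, for every `L`, every realising
Markov kernel family `κ` of the `SU(2)` lattice Langevin dynamics on `(ℤ/L)³`, every `C⁵` function `f` of the real link coordinates with
`Γ^A(f) ≤ σ²` on `SU(2)^E`, every `t ≥ 0` and all `Q, Q'`: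
`|∫ f∘coords dκ_t(Q) − ∫ f∘coords dκ_t(Q')| ≤ e^(−(1−12|β'|)t) · √(σ²/2) · ρ_L(Q,Q')`, `ρ_L = √(torusRiemannDistSq)` Shen–Zhu–Zhu's product Riemannian
distance.  (W₁-shadow of (4.5); the `W₂` contraction is NOT proved.) [cite: ShenZhuZhu2022, Theorem 4.2 (4.5)] -/
theorem wilson_transition_lipschitz_riemann_uniform (L : ℕ) [NeZero L] (Q Q' : GaugeConfig 3 L (Matrix.specialUnitaryGroup (Fin 2) ℂ)) (t : ℝ≥0)
    (β' : ℝ) (hβ : |β'| < 1 / 12)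
    (κ : ℝ≥0 → Kernel (GaugeConfig 3 L (Matrix.specialUnitaryGroup (Fin 2) ℂ))
      (GaugeConfig 3 L (Matrix.specialUnitaryGroup (Fin 2) ℂ))) [∀ t, IsMarkovKernel (κ t)]
    (hreal : ∀ (t : ℝ≥0) (x : GaugeConfig 3 L (Matrix.specialUnitaryGroup (Fin 2) ℂ))
        (Ω : Type) [MeasurableSpace Ω] (P : Measure Ω) [IsProbabilityMeasure P]
        (W : ℝ≥0 → Ω → (Edge 3 L × NoiseIdx 2 → ℝ)) (hW : IsFlatBrownian W P)
        (U : ℝ≥0 → Ω → GaugeConfig 3 L (Matrix.specialUnitaryGroup (Fin 2) ℂ)),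
        (∀ ω, U 0 ω = x) →
        (latticeLangevinDynamics (fundamentalLatticeRep 2) β').IsSolution (fundamentalRep (Fin 2))
          hW.natFiltration P W U →
        κ t x = P.map (U t))
    {f : (Edge 3 L × Fin 2 × Fin 2 × Bool → ℝ) → ℝ} (hf : ContDiff ℝ 5 f) {σ2 : ℝ} :
    let coords : GaugeConfig 3 L (Matrix.specialUnitaryGroup (Fin 2) ℂ) → (Edge 3 L × Fin 2 × Fin 2 × Bool → ℝ) :=
      fun V q => (fun z : ℂ => if q.2.2.2 then z.im else z.re)
        ((fundamentalRep (Fin 2) (V q.1) : Matrix (Fin 2) (Fin 2) ℂ) q.2.1 q.2.2.1)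
    let A : GaugeConfig 3 L (Matrix.specialUnitaryGroup (Fin 2) ℂ) → (Edge 3 L × Fin 2 × Fin 2 × Bool) →
        (Edge 3 L × Fin 2 × Fin 2 × Bool) → ℝ := fun V i j =>
      ∑ n : Edge 3 L × NoiseIdx 2,
        (if n.1 = i.1 then (fun z : ℂ => if i.2.2.2 then z.im else z.re)
          ((latticeLangevinDynamics (fundamentalLatticeRep 2) β').noise
            (matrixConfig (fundamentalRep (Fin 2)) V) i.1 n.2 i.2.1 i.2.2.1) else 0) *
        (if n.1 = j.1 then (fun z : ℂ => if j.2.2.2 then z.im else z.re)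
          ((latticeLangevinDynamics (fundamentalLatticeRep 2) β').noise
            (matrixConfig (fundamentalRep (Fin 2)) V) j.1 n.2 j.2.1 j.2.2.1) else 0)
    (∀ y, (∑ i : Edge 3 L × Fin 2 × Fin 2 × Bool, ∑ j : Edge 3 L × Fin 2 × Fin 2 × Bool,
        fderiv ℝ f (coords y) (Pi.single i 1) * fderiv ℝ f (coords y) (Pi.single j 1) * A y i j) ≤ σ2) →
      |∫ y, f (coords y) ∂(κ t Q) - ∫ y, f (coords y) ∂(κ t Q')| ≤
        Real.exp (-((1 - 12 * |β'|) * (t : ℝ))) * Real.sqrt (σ2 / 2) * Real.sqrt (torusRiemannDistSq (fundamentalLatticeRep 2) Q Q') := by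
  intro coords A hσ
  obtain ⟨g, hg, -, hgrep, hbound⟩ := wilson_lipschitz_contraction_uniform L β' hβ κ hreal hf t hσ
  have hlip := abs_sub_le_sqrt_carre_mul_sqrt_torusRiemannDistSq L β' (hg.differentiable (by norm_num)) hbound Q Q'
  rw [sqrt_exp_neg_two_mul_mul_div_two] at hlip
  rw [hgrep Q, hgrep Q', abs_sub_comm]
  exact hlip

/-- ★★ **The same in Frobenius currency**: `|∫ f∘coords dκ_t(Q) − ∫ f∘coords dκ_t(Q')| ≤ e^(−(1−12|β'|)t) · √(σ²/2) · (π/2) · √(Σ_e ‖Q'_e − Q_e‖_F²)`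
(`ρ_L ≤ (π/2)·√(Σ_e ‖Q'_e − Q_e‖_F²)`, G41).  Fixed cut-off; the Yang–Mills mass gap is NOT proved. [cite: ShenZhuZhu2022, Theorem 4.2 (4.5)] -/
theorem wilson_transition_lipschitz_frob_uniform (L : ℕ) [NeZero L] (Q Q' : GaugeConfig 3 L (Matrix.specialUnitaryGroup (Fin 2) ℂ)) (t : ℝ≥0)
    (β' : ℝ) (hβ : |β'| < 1 / 12)
    (κ : ℝ≥0 → Kernel (GaugeConfig 3 L (Matrix.specialUnitaryGroup (Fin 2) ℂ))
      (GaugeConfig 3 L (Matrix.specialUnitaryGroup (Fin 2) ℂ))) [∀ t, IsMarkovKernel (κ t)]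
    (hreal : ∀ (t : ℝ≥0) (x : GaugeConfig 3 L (Matrix.specialUnitaryGroup (Fin 2) ℂ))
        (Ω : Type) [MeasurableSpace Ω] (P : Measure Ω) [IsProbabilityMeasure P]
        (W : ℝ≥0 → Ω → (Edge 3 L × NoiseIdx 2 → ℝ)) (hW : IsFlatBrownian W P)
        (U : ℝ≥0 → Ω → GaugeConfig 3 L (Matrix.specialUnitaryGroup (Fin 2) ℂ)),
        (∀ ω, U 0 ω = x) →
        (latticeLangevinDynamics (fundamentalLatticeRep 2) β').IsSolution (fundamentalRep (Fin 2))
          hW.natFiltration P W U →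
        κ t x = P.map (U t))
    {f : (Edge 3 L × Fin 2 × Fin 2 × Bool → ℝ) → ℝ} (hf : ContDiff ℝ 5 f) {σ2 : ℝ} :
    let coords : GaugeConfig 3 L (Matrix.specialUnitaryGroup (Fin 2) ℂ) → (Edge 3 L × Fin 2 × Fin 2 × Bool → ℝ) :=
      fun V q => (fun z : ℂ => if q.2.2.2 then z.im else z.re)
        ((fundamentalRep (Fin 2) (V q.1) : Matrix (Fin 2) (Fin 2) ℂ) q.2.1 q.2.2.1)
    let A : GaugeConfig 3 L (Matrix.specialUnitaryGroup (Fin 2) ℂ) → (Edge 3 L × Fin 2 × Fin 2 × Bool) →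
        (Edge 3 L × Fin 2 × Fin 2 × Bool) → ℝ := fun V i j =>
      ∑ n : Edge 3 L × NoiseIdx 2,
        (if n.1 = i.1 then (fun z : ℂ => if i.2.2.2 then z.im else z.re)
          ((latticeLangevinDynamics (fundamentalLatticeRep 2) β').noise
            (matrixConfig (fundamentalRep (Fin 2)) V) i.1 n.2 i.2.1 i.2.2.1) else 0) *
        (if n.1 = j.1 then (fun z : ℂ => if j.2.2.2 then z.im else z.re)
          ((latticeLangevinDynamics (fundamentalLatticeRep 2) β').noise
            (matrixConfig (fundamentalRep (Fin 2)) V) j.1 n.2 j.2.1 j.2.2.1) else 0)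
    (∀ y, (∑ i : Edge 3 L × Fin 2 × Fin 2 × Bool, ∑ j : Edge 3 L × Fin 2 × Fin 2 × Bool,
        fderiv ℝ f (coords y) (Pi.single i 1) * fderiv ℝ f (coords y) (Pi.single j 1) * A y i j) ≤ σ2) →
      |∫ y, f (coords y) ∂(κ t Q) - ∫ y, f (coords y) ∂(κ t Q')| ≤
        Real.exp (-((1 - 12 * |β'|) * (t : ℝ))) * Real.sqrt (σ2 / 2) * (Real.pi / 2 *
          Real.sqrt (∑ e : Edge 3 L, hsForm 2 ((Q' e : Matrix (Fin 2) (Fin 2) ℂ) - (Q e : Matrix (Fin 2) (Fin 2) ℂ))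
            ((Q' e : Matrix (Fin 2) (Fin 2) ℂ) - (Q e : Matrix (Fin 2) (Fin 2) ℂ)))) := by
  intro coords A hσ
  have h := wilson_transition_lipschitz_riemann_uniform L Q Q' t β' hβ κ hreal hf hσ
  refine h.trans (mul_le_mul_of_nonneg_left ?_ (by positivity))
  have h0 : 0 ≤ ∑ e : Edge 3 L, hsForm 2 ((Q' e : Matrix (Fin 2) (Fin 2) ℂ) - (Q e : Matrix (Fin 2) (Fin 2) ℂ))
      ((Q' e : Matrix (Fin 2) (Fin 2) ℂ) - (Q e : Matrix (Fin 2) (Fin 2) ℂ)) := Finset.sum_nonneg fun e _ => hsForm_self_nonneg _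
  calc Real.sqrt (torusRiemannDistSq (fundamentalLatticeRep 2) Q Q')
      ≤ Real.sqrt (Real.pi ^ 2 / 4 * ∑ e : Edge 3 L, hsForm 2 ((Q' e : Matrix (Fin 2) (Fin 2) ℂ) - (Q e : Matrix (Fin 2) (Fin 2) ℂ))
          ((Q' e : Matrix (Fin 2) (Fin 2) ℂ) - (Q e : Matrix (Fin 2) (Fin 2) ℂ))) := Real.sqrt_le_sqrt (torusRiemannDistSq_two_le Q Q')
    _ = Real.pi / 2 * Real.sqrt (∑ e : Edge 3 L, hsForm 2 ((Q' e : Matrix (Fin 2) (Fin 2) ℂ) - (Q e : Matrix (Fin 2) (Fin 2) ℂ))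
          ((Q' e : Matrix (Fin 2) (Fin 2) ℂ) - (Q e : Matrix (Fin 2) (Fin 2) ℂ))) := by
        rw [Real.sqrt_mul (by positivity), show Real.pi ^ 2 / 4 = (Real.pi / 2) ^ 2 by ring, Real.sqrt_sq (by positivity)]

end Summit.QuantumFields.YangMills.Theorems.ColdStartUniversality

end
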